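import Mathlib
import HarnessLib
import Summits.HubbardSuperconductivity.HubbardSuperconductivity.Theorems.KLProgrammeKLRegimeSplitThermalLayerExt

/-!
# Route `KLProgramme` — ENGINE item stmt-HubbardSuperconductivity-20437 `KLRegimeEngineV17F2`, class-#5 STEP (X).3 pinned pair «88b» /
# located-risk #14 «(X).3-PINNED-NUMERIC»: THE ZERO-SOUND CONSTANT, SHARP — `(64/π)·M_F·L_W·Λ_n` in place of `(524288/π)·(ℓ+8M_F)·L_W·Λ_n`
# (cell gate-hubbard-kl, seat hubbard-kl-k3c2-p2 g22, technique «thermal-bar induction n ≤ nScales β + 1 with EngineBoundsAtV4S sums»)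

WHY.  The zero-sound (first-order) remainder of the weighted same-slice bubble, `∫∫ G(s)(ik₀+e)²(W(e)−W(0))` with `G = F/s²`, `s = k₀²+e²`, is bounded in
`klzw_integral_plane_weighted_norm_le` (…MatsubaraZeroSoundWeighted, «crudest constants») by `4·L_G·L_W·r⁷` from the pointwise bound `sup|G| ≤ L_G·r²`
(`L_G` the Lipschitz constant of `G`); in the annulus form (`klte_annulus_weighted_bubble_norm_le`, `r₁ = Λ/2`, `r₂ = 4Λ`) this pays `(r₂/r₁)⁶ = 2¹⁸` and
the Lipschitz constant `ℓ` of the shell weight where only its sup `M_F` is needed.  The sharp pointwise bound is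
`‖G(s)‖·s·|e| = ‖F(s)‖·|e|/s ≤ M_F/√s ≤ M_F/r₁` (since `|e| ≤ √s` and `F = 0` for `s ≤ r₁²`), whence on the same box
`‖∫∫ …‖ ≤ 4r₂²·(M_F/r₁)·L_W` and, in scale form, the zero-sound term **`(64/π)·M_F·L_W·Λ_n`** — smaller by `524288·(ℓ+8M_F)/(64·M_F)`
(`= 2^21.2` at the engine's slice weights `ℓ + 8M_F = 2343/Λ`, `M_F = 8/Λ`).  The thermal (Matsubara Riemann) term is unchanged.
* §1 `klzw_norm_integrand_sub_le_pt`, **`klzw_integral_plane_weighted_norm_le_pt`** (`≤ 4r²·K·L_W` under `‖G(s)‖·s·|e| ≤ K`),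
  **`klzw_discrete_weighted_bubble_norm_le_pt`** (`(2π)⁻¹·4r²·K·L_W + 8·L·B_W·r⁴(r+2π/β)/β`);
* §2 `klte_div_sq_weight_pt` (`K = M_F/r₁` for `G = F/s²` on the annulus), **`klte_annulus_weighted_bubble_norm_le_pt`**,
  **`klte_slice_bubble_weighted_norm_le_sharp`** (scale form: `(64/π)·M_F·L_W·Λ_n + (393216/π)·(ℓ+8M_F)·B_W·(π/β)/Λ_n`).
Pure analysis on the tree's objects (same hypotheses as the originals); nothing about the model is asserted; nothing asserts (X).3, (c), K3 or
superconductivity.  References: BGM 2006 §2.5 (2.56a)–(2.56e) [cite: BenfattoGiulianiMastropietro2006].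
-/

noncomputable section

namespace Summit.HubbardSuperconductivity.HubbardSuperconductivity.Theorems.KLRegimeSplit

set_option linter.dupNamespace false -- summit = problem name (single-conjunct summit), D-0017

open Real Finset MeasureTheory Complex Literature.MathematicalPhysics.QuantumLattice Literature.Probability.LatticeModels
open Summit.HubbardSuperconductivity.HubbardSuperconductivity.Theorems
open Summit.HubbardSuperconductivity.HubbardSuperconductivity.Theorems.KLProgrammeLegKernels

/-! ## §1 The continuum and discrete weighted bubble under a POINTWISE weight bound -/

section Weighted

variable {G : ℝ → ℂ} {L r K : ℝ} {W : ℝ → ℂ} {LW BW : ℝ}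

/-- **Sharp first-order pointwise bound**: if `‖G(s)‖·s·|e| ≤ K` (`s = k₀²+e²`) and `G(s) = 0` for `s ≥ r²`, then
`‖Ψ_G(k₀,e)·(W(e) − W(0))‖ ≤ K·L_W` everywhere. -/
theorem klzw_norm_integrand_sub_le_pt (hsupp : ∀ s, r ^ 2 ≤ s → G s = 0) (hr : 0 < r) (hLW : 0 ≤ LW)
    (hWlip : ∀ e : ℝ, |e| < r → ‖W e - W 0‖ ≤ LW * |e|) (hK0 : 0 ≤ K)
    (hK : ∀ k₀ e : ℝ, ‖G (k₀ ^ 2 + e ^ 2)‖ * (k₀ ^ 2 + e ^ 2) * |e| ≤ K) (k₀ e : ℝ) :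
    ‖G (k₀ ^ 2 + e ^ 2) * (I * k₀ + e) ^ 2 * (W e - W 0)‖ ≤ K * LW := by
  rcases lt_or_ge (k₀ ^ 2 + e ^ 2) (r ^ 2) with hs | hs
  · have he : |e| < r := by nlinarith [sq_abs e, sq_nonneg k₀, abs_nonneg e]
    rw [norm_mul, norm_mul, klzd_norm_lin_sq]
    have hG0 : 0 ≤ ‖G (k₀ ^ 2 + e ^ 2)‖ * (k₀ ^ 2 + e ^ 2) := by positivity
    calc ‖G (k₀ ^ 2 + e ^ 2)‖ * (k₀ ^ 2 + e ^ 2) * ‖W e - W 0‖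
        ≤ ‖G (k₀ ^ 2 + e ^ 2)‖ * (k₀ ^ 2 + e ^ 2) * (LW * |e|) := mul_le_mul_of_nonneg_left (hWlip e he) hG0
      _ = ‖G (k₀ ^ 2 + e ^ 2)‖ * (k₀ ^ 2 + e ^ 2) * |e| * LW := by ring
      _ ≤ K * LW := mul_le_mul_of_nonneg_right (hK k₀ e) hLW
  · rw [hsupp _ hs, zero_mul, zero_mul, norm_zero]; positivity

/-- **First-order cancellation in the continuum, sharp form**: `‖∫∫ G(k₀²+e²)(ik₀+e)²·W(e)‖ ≤ 4r²·K·L_W` under the pointwise weight bound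
`‖G(s)‖·s·|e| ≤ K` (the `W(0)`-part vanishes by `klzd_integral_plane_eq_zero`; the rest is `≤ K·L_W` on the box `[−r,r]²`). -/
theorem klzw_integral_plane_weighted_norm_le_pt (hlip : ∀ s s', ‖G s - G s'‖ ≤ L * |s - s'|) (hsupp : ∀ s, r ^ 2 ≤ s → G s = 0)
    (hr : 0 < r) (hW : Continuous W) (hLW : 0 ≤ LW) (hWlip : ∀ e : ℝ, |e| < r → ‖W e - W 0‖ ≤ LW * |e|) (hK0 : 0 ≤ K)
    (hK : ∀ k₀ e : ℝ, ‖G (k₀ ^ 2 + e ^ 2)‖ * (k₀ ^ 2 + e ^ 2) * |e| ≤ K) :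
    ‖∫ p : ℝ × ℝ, G (p.1 ^ 2 + p.2 ^ 2) * (I * p.1 + p.2) ^ 2 * W p.2‖ ≤ 4 * r ^ 2 * K * LW := by
  -- integrability of the three integrands (continuous, supported in the closed box of half-width r)
  have hΨ : Continuous fun p : ℝ × ℝ => G (p.1 ^ 2 + p.2 ^ 2) * (I * p.1 + p.2) ^ 2 := klzd_continuous hlip
  have hsuppK : ∀ (c : ℝ × ℝ → ℂ), HasCompactSupport fun p : ℝ × ℝ => G (p.1 ^ 2 + p.2 ^ 2) * (I * p.1 + p.2) ^ 2 * c p := by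
    intro c
    refine HasCompactSupport.intro ((isCompact_Icc (a := -r) (b := r)).prod (isCompact_Icc (a := -r) (b := r))) fun p hp => ?_
    exact klzw_integrand_zero_of_not_mem hsupp hr.le hp (c p)
  have hI1 : Integrable fun p : ℝ × ℝ => G (p.1 ^ 2 + p.2 ^ 2) * (I * p.1 + p.2) ^ 2 * (W p.2 - W 0) :=
    (hΨ.mul ((hW.comp continuous_snd).sub continuous_const)).integrable_of_hasCompactSupport (hsuppK fun p => W p.2 - W 0)
  have hI2 : Integrable fun p : ℝ × ℝ => G (p.1 ^ 2 + p.2 ^ 2) * (I * p.1 + p.2) ^ 2 * W 0 :=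
    (hΨ.mul continuous_const).integrable_of_hasCompactSupport (hsuppK fun _ => W 0)
  -- split `W = (W − W 0) + W 0`
  have hsplit : (fun p : ℝ × ℝ => G (p.1 ^ 2 + p.2 ^ 2) * (I * p.1 + p.2) ^ 2 * W p.2) =
      fun p => G (p.1 ^ 2 + p.2 ^ 2) * (I * p.1 + p.2) ^ 2 * (W p.2 - W 0) + G (p.1 ^ 2 + p.2 ^ 2) * (I * p.1 + p.2) ^ 2 * W 0 := by
    funext p; ring
  rw [hsplit, integral_add hI1 hI2, integral_mul_const, klzd_integral_plane_eq_zero G, zero_mul, add_zero]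
  -- the first-order part: pointwise ≤ indicator of the box × `K·L_W`
  set c : ℝ := K * LW with hc
  have hbound : ∀ p : ℝ × ℝ, ‖G (p.1 ^ 2 + p.2 ^ 2) * (I * p.1 + p.2) ^ 2 * (W p.2 - W 0)‖ ≤
      Set.indicator (Set.Icc (-r) r ×ˢ Set.Icc (-r) r) (fun _ => c) p := by
    intro p
    by_cases hp : p ∈ Set.Icc (-r) r ×ˢ Set.Icc (-r) r
    · rw [Set.indicator_of_mem hp]
      exact klzw_norm_integrand_sub_le_pt hsupp hr hLW hWlip hK0 hK p.1 p.2
    · rw [Set.indicator_of_notMem hp, klzw_integrand_zero_of_not_mem hsupp hr.le hp, norm_zero]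
  have hmeas : MeasurableSet (Set.Icc (-r) r ×ˢ Set.Icc (-r) r : Set (ℝ × ℝ)) := measurableSet_Icc.prod measurableSet_Icc
  have hfin : (volume : Measure (ℝ × ℝ)) (Set.Icc (-r) r ×ˢ Set.Icc (-r) r) ≠ ⊤ := by
    rw [klzw_volume_box r]; exact ENNReal.mul_ne_top ENNReal.ofReal_ne_top ENNReal.ofReal_ne_top
  have hind : Integrable (Set.indicator (Set.Icc (-r) r ×ˢ Set.Icc (-r) r) (fun _ : ℝ × ℝ => c)) :=
    IntegrableOn.integrable_indicator (integrableOn_const hfin) hmeas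
  calc ‖∫ p : ℝ × ℝ, G (p.1 ^ 2 + p.2 ^ 2) * (I * p.1 + p.2) ^ 2 * (W p.2 - W 0)‖
      ≤ ∫ p : ℝ × ℝ, Set.indicator (Set.Icc (-r) r ×ˢ Set.Icc (-r) r) (fun _ => c) p :=
        norm_integral_le_of_norm_le hind (Filter.Eventually.of_forall hbound)
    _ = ((volume : Measure (ℝ × ℝ)) (Set.Icc (-r) r ×ˢ Set.Icc (-r) r)).toReal * c := by
        rw [integral_indicator_const _ hmeas, smul_eq_mul, Measure.real]
    _ = (2 * r) * (2 * r) * c := by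
        rw [klzw_volume_box r, ENNReal.toReal_mul, ENNReal.toReal_ofReal (by linarith)]
    _ = 4 * r ^ 2 * K * LW := by rw [hc]; ring

/-- **The weighted zero-sound bubble of a radial weight at finite temperature, sharp zero-sound term.**  For `G : ℝ → ℂ` `L`-Lipschitz with `G(s) = 0` for
`s ≥ r²` (`r > 0`) and the pointwise weight bound `‖G(s)‖·s·|e| ≤ K` (`s = k₀² + e²`, `0 ≤ K`), a continuous insertion `W` with `‖W(e) − W(0)‖ ≤ L_W|e|`,
`‖W(e)‖ ≤ B_W` on `|e| < r`, `β > 0`, `M ≥ βr/(2π) + 1`: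
`‖β⁻¹ • Σ_i ∫ G(ω_i² + e²)(iω_i + e)² W(e) de‖ ≤ (2π)⁻¹·4r²·K·L_W + 8·L·B_W·r⁴·(r + 2π/β)/β`. -/
theorem klzw_discrete_weighted_bubble_norm_le_pt (hlip : ∀ s s', ‖G s - G s'‖ ≤ L * |s - s'|)
    (hsupp : ∀ s, r ^ 2 ≤ s → G s = 0) (hr : 0 < r) (hW : Continuous W) (hLW : 0 ≤ LW) (hBW : 0 ≤ BW)
    (hWlip : ∀ e : ℝ, |e| < r → ‖W e - W 0‖ ≤ LW * |e|) (hWbd : ∀ e : ℝ, |e| < r → ‖W e‖ ≤ BW) (hK0 : 0 ≤ K)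
    (hK : ∀ k₀ e : ℝ, ‖G (k₀ ^ 2 + e ^ 2)‖ * (k₀ ^ 2 + e ^ 2) * |e| ≤ K)
    {β : ℝ} (hβ : 0 < β) {M : ℕ} (hM : β * r / (2 * Real.pi) + 1 ≤ M) :
    ‖β⁻¹ • ∑ i : MatsubaraIdx M,
        ∫ e : ℝ, G (matsubaraFreq β M i ^ 2 + e ^ 2) * (I * (matsubaraFreq β M i) + e) ^ 2 * W e‖ ≤
      (2 * Real.pi)⁻¹ * (4 * r ^ 2 * K * LW) + 8 * L * BW * r ^ 4 * (r + 2 * Real.pi / β) / β := by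
  have hL : 0 ≤ L := by
    have := hlip 0 1; have h0 : (0:ℝ) ≤ ‖G 0 - G 1‖ := norm_nonneg _; norm_num at this; linarith
  set g : ℝ → ℂ := fun k₀ => ∫ e : ℝ, G (k₀ ^ 2 + e ^ 2) * (I * k₀ + e) ^ 2 * W e with hg
  have hD : 0 ≤ 8 * L * BW * r ^ 4 := by positivity
  have hglip : ∀ t t', ‖g t - g t'‖ ≤ 8 * L * BW * r ^ 4 * |t - t'| := fun t t' =>
    klzw_freqFn_lipschitz hlip hsupp hr hW hBW hWbd t t'
  have hgsupp : ∀ t, r ≤ |t| → g t = 0 := fun t ht => klzw_freqFn_zero hsupp hr.le ht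
  have h1 := klmr_matsubara_sum_sub_integral_norm_le hD hglip hr.le hgsupp hβ hM
  have h2 : ‖(2 * Real.pi)⁻¹ • ∫ t, g t‖ ≤ (2 * Real.pi)⁻¹ * (4 * r ^ 2 * K * LW) := by
    rw [norm_smul, Real.norm_of_nonneg (by positivity), hg, klzw_integral_freqFn_eq hlip hsupp hr.le hW]
    exact mul_le_mul_of_nonneg_left (klzw_integral_plane_weighted_norm_le_pt hlip hsupp hr hW hLW hWlip hK0 hK) (by positivity)
  calc ‖β⁻¹ • ∑ i : MatsubaraIdx M, g (matsubaraFreq β M i)‖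
      = ‖(β⁻¹ • ∑ i : MatsubaraIdx M, g (matsubaraFreq β M i) - (2 * Real.pi)⁻¹ • ∫ t, g t) + (2 * Real.pi)⁻¹ • ∫ t, g t‖ := by
        rw [sub_add_cancel]
    _ ≤ ‖β⁻¹ • ∑ i : MatsubaraIdx M, g (matsubaraFreq β M i) - (2 * Real.pi)⁻¹ • ∫ t, g t‖ + ‖(2 * Real.pi)⁻¹ • ∫ t, g t‖ :=
        norm_add_le _ _
    _ ≤ 8 * L * BW * r ^ 4 * (r + 2 * Real.pi / β) / β + (2 * Real.pi)⁻¹ * (4 * r ^ 2 * K * LW) := add_le_add h1 h2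
    _ = (2 * Real.pi)⁻¹ * (4 * r ^ 2 * K * LW) + 8 * L * BW * r ^ 4 * (r + 2 * Real.pi / β) / β := by ring

end Weighted

/-! ## §2 The annulus form and the scale form with the sharp zero-sound term -/

section SliceBubble

variable {F : ℝ → ℂ} {LF MF ℓ : ℝ} {W : ℝ → ℂ} {LW BW : ℝ}

/-- **The pointwise weight bound for `G = F/s²` on the annulus**: if `‖F‖ ≤ M_F` and `F(s) = 0` for `s ≤ r₁²` (`r₁ > 0`), then
`‖F(s)/s²‖·s·|e| ≤ M_F/r₁` for `s = k₀² + e²` (`‖F(s)‖·|e|/s ≤ M_F/√s ≤ M_F/r₁` as `|e| ≤ √s` and `s > r₁²` on the support). -/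
theorem klte_div_sq_weight_pt {r₁ : ℝ} (hbd : ∀ s, ‖F s‖ ≤ MF) (hin : ∀ s, s ≤ r₁ ^ 2 → F s = 0) (hr₁ : 0 < r₁) (k₀ e : ℝ) :
    ‖F (k₀ ^ 2 + e ^ 2) / (((k₀ ^ 2 + e ^ 2 : ℝ)) : ℂ) ^ 2‖ * (k₀ ^ 2 + e ^ 2) * |e| ≤ MF / r₁ := by
  have hMF : 0 ≤ MF := (norm_nonneg _).trans (hbd 0)
  set s : ℝ := k₀ ^ 2 + e ^ 2 with hs_def
  rcases le_or_gt s (r₁ ^ 2) with hs | hs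
  · rw [hin s hs, zero_div, norm_zero, zero_mul, zero_mul]; positivity
  · have hs0 : 0 < s := lt_of_le_of_lt (by positivity) hs
    have hnorm : ‖F s / ((s : ℝ) : ℂ) ^ 2‖ = ‖F s‖ / s ^ 2 := by
      rw [norm_div, norm_pow, Complex.norm_real, Real.norm_of_nonneg hs0.le]
    rw [hnorm]
    -- `|e| ≤ √s` and `r₁ < √s`
    have hes : |e| ≤ Real.sqrt s := by
      rw [← Real.sqrt_sq_eq_abs]
      exact Real.sqrt_le_sqrt (by rw [hs_def]; nlinarith [sq_nonneg k₀])
    have hr₁s : r₁ ≤ Real.sqrt s := by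
      rw [← Real.sqrt_sq hr₁.le]
      exact Real.sqrt_le_sqrt hs.le
    have hsq : Real.sqrt s * Real.sqrt s = s := Real.mul_self_sqrt hs0.le
    have hsqpos : 0 < Real.sqrt s := Real.sqrt_pos.mpr hs0
    -- `‖F s‖/s² · s · |e| = ‖F s‖ · |e| / s ≤ M_F · √s / s = M_F/√s ≤ M_F/r₁`
    have h1 : ‖F s‖ / s ^ 2 * s * |e| = ‖F s‖ * |e| / s := by
      field_simp
    rw [h1, div_le_div_iff₀ hs0 hr₁]
    calc ‖F s‖ * |e| * r₁ ≤ MF * Real.sqrt s * Real.sqrt s := by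
          have := hbd s
          exact mul_le_mul (mul_le_mul this hes (abs_nonneg _) hMF) hr₁s hr₁.le (by positivity)
      _ = MF * s := by rw [mul_assoc, hsq]

/-- **The weighted discrete bubble in the carrier's variables, sharp zero-sound term** (annulus form of `klzw_discrete_weighted_bubble_norm_le_pt`):
for a shell weight `F : ℝ → ℂ` (`L_F`-Lipschitz in `s = t²`, `‖F‖ ≤ M_F`, `F(s) = 0` for `s ≤ r₁²` and for `s ≥ r₂²`, `0 < r₁`, `0 < r₂`), an insertion
`W` (continuous, `‖W(e) − W(0)‖ ≤ L_W|e|` and `‖W(e)‖ ≤ B_W` for `|e| < r₂`, `0 ≤ L_W, B_W`), `β > 0`, `M ≥ βr₂/(2π) + 1`: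
`‖β⁻¹ • Σ_i ∫ F(ω_i² + e²)·((−iω_i + e)²)⁻¹·W(e) de‖ ≤ (2π)⁻¹·4r₂²·(M_F/r₁)·L_W + 8·L_G·B_W·r₂⁴·(r₂ + 2π/β)/β`, `L_G = L_F/r₁⁴ + 2M_F/r₁⁶`. -/
theorem klte_annulus_weighted_bubble_norm_le_pt {r₁ r₂ : ℝ} (hlip : ∀ s s', ‖F s - F s'‖ ≤ LF * |s - s'|) (hbd : ∀ s, ‖F s‖ ≤ MF)
    (hin : ∀ s, s ≤ r₁ ^ 2 → F s = 0) (hout : ∀ s, r₂ ^ 2 ≤ s → F s = 0) (hr₁ : 0 < r₁) (hr₂ : 0 < r₂)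
    (hW : Continuous W) (hLW : 0 ≤ LW) (hBW : 0 ≤ BW)
    (hWlip : ∀ e : ℝ, |e| < r₂ → ‖W e - W 0‖ ≤ LW * |e|) (hWbd : ∀ e : ℝ, |e| < r₂ → ‖W e‖ ≤ BW)
    {β : ℝ} (hβ : 0 < β) {M : ℕ} (hM : β * r₂ / (2 * Real.pi) + 1 ≤ M) :
    ‖β⁻¹ • ∑ i : MatsubaraIdx M,
        ∫ e : ℝ, F (matsubaraFreq β M i ^ 2 + e ^ 2) * ((-I * (matsubaraFreq β M i) + e) ^ 2)⁻¹ * W e‖ ≤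
      (2 * Real.pi)⁻¹ * (4 * r₂ ^ 2 * (MF / r₁) * LW) +
        8 * (LF / r₁ ^ 4 + 2 * MF / r₁ ^ 6) * BW * r₂ ^ 4 * (r₂ + 2 * Real.pi / β) / β := by
  have hMF : 0 ≤ MF := (norm_nonneg _).trans (hbd 0)
  -- pass to the singularity-free form `G(s)(ik₀+e)²`, `G = F/s²`
  set G : ℝ → ℂ := fun s => F s / ((s : ℝ) : ℂ) ^ 2 with hG
  have hGlip : ∀ s s', ‖G s - G s'‖ ≤ (LF / r₁ ^ 4 + 2 * MF / r₁ ^ 6) * |s - s'| := fun s s' =>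
    klza_div_sq_lipschitz hlip hbd hin hr₁ s s'
  have hGsupp : ∀ s, r₂ ^ 2 ≤ s → G s = 0 := fun s hs => by simp only [hG, hout s hs, zero_div]
  have hGK : ∀ k₀ e : ℝ, ‖G (k₀ ^ 2 + e ^ 2)‖ * (k₀ ^ 2 + e ^ 2) * |e| ≤ MF / r₁ := fun k₀ e => by
    simp only [hG]
    exact klte_div_sq_weight_pt hbd hin hr₁ k₀ e
  have hconv : ∀ (k₀ e : ℝ), F (k₀ ^ 2 + e ^ 2) * ((-I * k₀ + e) ^ 2)⁻¹ = G (k₀ ^ 2 + e ^ 2) * (I * k₀ + e) ^ 2 := by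
    intro k₀ e
    rw [klzd_integrand_eq G k₀ e]
    congr 1
    simp only [hG]
    by_cases hz : ((k₀ ^ 2 + e ^ 2 : ℝ) : ℂ) = 0
    · have hz' : k₀ ^ 2 + e ^ 2 = 0 := by exact_mod_cast hz
      have hk : k₀ = 0 := by nlinarith [sq_nonneg k₀, sq_nonneg e]
      have he : e = 0 := by nlinarith [sq_nonneg k₀, sq_nonneg e]
      subst hk; subst he
      have : F 0 = 0 := hin 0 (by positivity)
      simp [this]
    · field_simp
  simp_rw [hconv]
  exact klzw_discrete_weighted_bubble_norm_le_pt hGlip hGsupp hr₂ hW hLW hBW hWlip hWbd (by positivity) hGK hβ hM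

/-- **The same-slice zero-transfer particle–hole bubble with an insertion, in scale form, SHARP zero-sound term.**  At scale `n ≤ n_β + 1`
(`β ≥ klBetaMin`): a shell weight `F : ℝ → ℂ` with `‖F‖ ≤ M_F` (`0 ≤ M_F`), `L_F`-Lipschitz in `s = t²` with `L_F ≤ ℓ/Λ_n²`, `F(s) = 0` for `s ≤ (Λ_n/2)²`
and for `s ≥ (4Λ_n)²`; an insertion `W : ℝ → ℂ` continuous with `‖W(e) − W(0)‖ ≤ L_W|e|`, `‖W(e)‖ ≤ B_W` for `|e| < 4Λ_n` (`0 ≤ L_W, B_W`); every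
Matsubara cutoff `M ≥ β·4Λ_n/(2π) + 1`.  Then
`‖β⁻¹ • Σ_i ∫ F(ω_i² + e²)·((−iω_i + e)²)⁻¹·W(e) de‖ ≤ (64/π)·M_F·L_W·Λ_n + (393216/π)·(ℓ + 8M_F)·B_W·(π/β)/Λ_n` —
zero-sound remainder (insertion slope × scale, sup of the weight only) plus the thermal term of `klte_slice_bubble_weighted_norm_le` (unchanged). -/
theorem klte_slice_bubble_weighted_norm_le_sharp (hMF : 0 ≤ MF) (hlip : ∀ s s', ‖F s - F s'‖ ≤ LF * |s - s'|) (hbd : ∀ s, ‖F s‖ ≤ MF)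
    {n : ℕ} (hLF : LF ≤ ℓ / klScale klE0 n ^ 2)
    (hin : ∀ s, s ≤ (klScale klE0 n / 2) ^ 2 → F s = 0) (hout : ∀ s, (4 * klScale klE0 n) ^ 2 ≤ s → F s = 0)
    (hW : Continuous W) (hLW : 0 ≤ LW) (hBW : 0 ≤ BW)
    (hWlip : ∀ e : ℝ, |e| < 4 * klScale klE0 n → ‖W e - W 0‖ ≤ LW * |e|)
    (hWbd : ∀ e : ℝ, |e| < 4 * klScale klE0 n → ‖W e‖ ≤ BW)
    {β : ℝ} (hβ : klBetaMin ≤ β) (hn : n ≤ nScales β + 1) {M : ℕ}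
    (hM : β * (4 * klScale klE0 n) / (2 * Real.pi) + 1 ≤ M) :
    ‖β⁻¹ • ∑ i : MatsubaraIdx M,
        ∫ e : ℝ, F (matsubaraFreq β M i ^ 2 + e ^ 2) * ((-I * (matsubaraFreq β M i) + e) ^ 2)⁻¹ * W e‖ ≤
      64 / Real.pi * MF * LW * klScale klE0 n +
        393216 / Real.pi * (ℓ + 8 * MF) * BW * ((Real.pi / β) / klScale klE0 n) := by
  set Λ := klScale klE0 n with hΛdef
  have hΛ : 0 < Λ := klth_klScale_pos n
  have hβ0 : 0 < β := pos_of_klBetaMin_le hβ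
  have h0 := klte_annulus_weighted_bubble_norm_le_pt hlip hbd hin hout (by positivity : 0 < Λ / 2) (by positivity : 0 < 4 * Λ)
    hW hLW hBW hWlip hWbd hβ0 hM
  refine h0.trans ?_
  -- the Lipschitz constant of `G` (thermal term only)
  have hLG := klte_LG_le (ℓ := ℓ) (MF := MF) hΛ hLF
  have hℓ : 0 ≤ ℓ := by
    have hLF0 : 0 ≤ LF := by
      have := hlip 0 1; have h0' : (0:ℝ) ≤ ‖F 0 - F 1‖ := norm_nonneg _; norm_num at this; linarith
    have : 0 ≤ ℓ / Λ ^ 2 := hLF0.trans hLF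
    rwa [le_div_iff₀ (by positivity), zero_mul] at this
  have hK : 0 ≤ ℓ + 8 * MF := by positivity
  -- the mesh: `4Λ + 2π/β ≤ 12Λ`
  have hmesh : 4 * Λ + 2 * Real.pi / β ≤ 12 * Λ := by
    have := klte_two_pi_div_le_eight_mul_klScale hβ hn
    rw [← hΛdef] at this
    linarith
  -- first term: `(2π)⁻¹·4·(4Λ)²·(M_F/(Λ/2))·L_W = (64/π)·M_F·L_W·Λ`
  have h1 : (2 * Real.pi)⁻¹ * (4 * (4 * Λ) ^ 2 * (MF / (Λ / 2)) * LW) = 64 / Real.pi * MF * LW * Λ := by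
    field_simp
    ring
  -- second term (verbatim from `klte_slice_bubble_weighted_norm_le`)
  have h2 : 8 * (LF / (Λ / 2) ^ 4 + 2 * MF / (Λ / 2) ^ 6) * BW * (4 * Λ) ^ 4 * (4 * Λ + 2 * Real.pi / β) / β ≤
      393216 / Real.pi * (ℓ + 8 * MF) * BW * ((Real.pi / β) / Λ) := by
    have hstep : 8 * (LF / (Λ / 2) ^ 4 + 2 * MF / (Λ / 2) ^ 6) * BW * (4 * Λ) ^ 4 * (4 * Λ + 2 * Real.pi / β) ≤
        8 * (16 * (ℓ + 8 * MF) / Λ ^ 6) * BW * (4 * Λ) ^ 4 * (12 * Λ) := by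
      have h44 : 0 ≤ (4 * Λ) ^ 4 := by positivity
      have hm0 : 0 ≤ 4 * Λ + 2 * Real.pi / β := by positivity
      exact mul_le_mul (mul_le_mul_of_nonneg_right (mul_le_mul_of_nonneg_right
        (mul_le_mul_of_nonneg_left hLG (by norm_num)) hBW) h44) hmesh hm0 (by positivity)
    have heq : 8 * (16 * (ℓ + 8 * MF) / Λ ^ 6) * BW * (4 * Λ) ^ 4 * (12 * Λ) = 393216 * (ℓ + 8 * MF) * BW / Λ := by
      field_simp; ring
    rw [heq] at hstep
    calc 8 * (LF / (Λ / 2) ^ 4 + 2 * MF / (Λ / 2) ^ 6) * BW * (4 * Λ) ^ 4 * (4 * Λ + 2 * Real.pi / β) / β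
        ≤ (393216 * (ℓ + 8 * MF) * BW / Λ) / β := div_le_div_of_nonneg_right hstep hβ0.le
      _ = 393216 / Real.pi * (ℓ + 8 * MF) * BW * ((Real.pi / β) / Λ) := by field_simp
  rw [h1]
  exact add_le_add le_rfl h2

/-- **The gain, as a number**: at the engine's slice weights (`M_F = 8/Λ`, `ℓ + 8M_F = 2343/Λ`, any `Λ > 0`) the sharp zero-sound coefficient
`(64/π)·M_F` is below the coefficient of record `(524288/π)·(ℓ + 8M_F)` by the factor `2^21` (indeed `64·8·2^21 ≤ 524288·2343`). -/
theorem klte_sharp_zs_gain {Λ : ℝ} (hΛ : 0 < Λ) :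
    (2 : ℝ) ^ 21 * (64 / Real.pi * (8 / Λ)) ≤ 524288 / Real.pi * (2343 / Λ) := by
  rw [show (2 : ℝ) ^ 21 * (64 / Real.pi * (8 / Λ)) = (2 ^ 21 * 64 * 8) / Real.pi / Λ by ring,
    show (524288 : ℝ) / Real.pi * (2343 / Λ) = (524288 * 2343) / Real.pi / Λ by ring]
  have h : (2 : ℝ) ^ 21 * 64 * 8 ≤ 524288 * 2343 := by norm_num
  exact div_le_div_of_nonneg_right (div_le_div_of_nonneg_right h Real.pi_pos.le) hΛ.le

end SliceBubble

end Summit.HubbardSuperconductivity.HubbardSuperconductivity.Theorems.KLRegimeSplit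

end
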